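import Summits.ValiantsHypothesis.ValiantsHypothesis.Theorems.BarrierLeverSuccinctHittingSetsForVPStubReadOnceGenerator
import Summits.ValiantsHypothesis.ValiantsHypothesis.Theorems.BarrierLeverSuccinctHittingSetsForVPGenerator
import Literature.Barriers.ValiantsHypothesis.GKSS17FSVPresentation

/-!
# Crux `BarrierLever.SuccinctHittingSetsForVP` (stmt-ValiantsHypothesis-14610), line `registered`
(birth), wave 10 — stub `stub_readOnceHit`: (preprocessed) READ-ONCE distinguishers are hit by
`SmallCircuits ℂ n 10`

Registered stub of line `birth` (LEDGER registry, wave 10 of 2026-08-17, lead c5, skeleton sha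
`c792cfbe…`; the text is NOT in the tree's `Cruxes/SuccinctHittingSetsForVP/Lines/birth.lean` v20 —
the registered signature is reproduced verbatim below): eventually in `n`, the coefficient vectors
of `SmallCircuits ℂ n 10` (degree `≤ n`, fan-in-two size `≤ n^10`) hit every nonzero polynomial in
the `N = C(2n,n)` coefficient variables computed by a preprocessed read-once formula (`IsPROP`,
Minahan–Volkovich Def. 12; any size, any degree) — such a polynomial is never an algebraically natural
proof against `VP` in Forbes–Shpilka–Volk's regime `d = n`.

Proof = glue of LANDED pieces by name (`n₀ = 24`, `t = 4n` seeds):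
* the succinct Shpilka–Volkovich generator of wave 2, `Γ_μ = coeff_μ f₀ + Σ_{j<4n} W_j ∏_i ℓ_{μ_i}(Z_{j,i})`
  (`stub_fullSupport` for `f₀`, `stub_lagrangeIndicator` for the indicators `ℓ_k` of `{0,…,n}`,
  `GeneratorGlue.eval_indicator`: `∏_i ℓ_{μ_i}(ν_i) = [μ = ν]` — a Lagrange family on
  `ι = degLEMonomials n` with `Z = Fin n`);
* `|degLEMonomials n| = C(2n,n) ≤ 2^{2n} < 2^{4n}` (`GKSS2017.card_degLEMonomials`);
* `stub_readOnceGenerator` (p577144; Shpilka–Volkovich 2015 Thm. 1 via `ReadOnceGenerator.core`):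
  `D ∘ Γ ≠ 0` for every nonzero PROP `D`;
* realisability of every value `Γ(p)` as the coefficient vector of a member of `SmallCircuits ℂ n 10`,
  verbatim as in `stub_generatorGlue` (`stub_separableCoeff`, `GeneratorGlue.add_sum_mem_smallCircuits`
  with `size_budget` at `a = 2`, `coeff_add_sum`, `eval_generator`, `eval_prod_aeval`);
* the generator principle `Generator.exists_mem_smallCircuits_of_aeval_ne_zero` (FSV §3).

Honest framing: with `stub_readOnceGenerator` this completes the read-once branch of wave 10 of line
birth (FSV18 Thm-9-type evidence: read-once distinguishers carved out of level one of FSV Question 6);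
the heart `stub_heart` ≡ the crux `SuccinctHittingSetsForVP ℂ` (= FSV Question 6) remains OPEN;
nothing here bears on `VP ≠ VNP`.

References: [ShpilkaVolkovich2015] A. Shpilka, I. Volkovich, Comput. Complexity 24 (2015), Thm. 1;
[MinahanVolkovich2017] D. Minahan, I. Volkovich, CCC 2017, Def. 12; [ForbesShpilkaVolk2018]
M. Forbes, A. Shpilka, B. L. Volk, Theory Comput. 14 (2018), §3, Construction 25/29, Question 6.
-/

-- Lint note (RULING #34 (6) / lead-np RECORD (611)(b)): this file, like `…StubReadOnceGenerator.lean`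
-- (its l.39) and every `Theorems/` file of this summit, disables ONLY `linter.dupNamespace`: the layout
-- `Summits/ValiantsHypothesis/ValiantsHypothesis/…` duplicates the namespace component
-- `ValiantsHypothesis`, which that linter flags on every declaration; nothing else is disabled.
set_option linter.dupNamespace false

noncomputable section

namespace Summit.ValiantsHypothesis.ValiantsHypothesis.Theorems.BarrierLever.SuccinctHittingSetsForVP

open Literature.Barriers.ValiantsHypothesis Literature.Computability.AlgebraicComplexity MvPolynomial

/-- **Registered stub `stub_readOnceHit`** (crux stmt-ValiantsHypothesis-14610, line `birth`; ledger
registry wave 10 of 2026-08-17, skeleton sha `c792cfbe…`, text not in `birth.lean` v20; signature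
verbatim): for all `n ≥ 24`, `SmallCircuits ℂ n 10` is a succinct hitting set for the preprocessed
read-once polynomials in the coefficient variables. Wave-2 succinct Shpilka–Volkovich generator with
`4n` seeds (`stub_fullSupport`, `stub_lagrangeIndicator`, `stub_separableCoeff`, `GeneratorGlue.*`),
`stub_readOnceGenerator`, `|degLEMonomials n| = C(2n,n) < 2^{4n}`, and the generator principle.
[cite: ForbesShpilkaVolk2018, §3 and Construction 29] [cite: ShpilkaVolkovich2015, Thm. 1] -/
theorem stub_readOnceHit :
    ∃ n₀ : ℕ, ∀ n : ℕ, n₀ ≤ n → IsSuccinctHittingSet (degLEMonomials n) (SmallCircuits ℂ n 10)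
      {D | ∃ S : Finset (degLEMonomials n), IsPROP S D} := by
  refine ⟨24, fun n hn D hD hD0 => ?_⟩
  obtain ⟨S, hS⟩ := hD
  obtain ⟨ℓ, hℓ⟩ := stub_lagrangeIndicator n
  obtain ⟨f₀, hf₀, -⟩ := stub_fullSupport n (by omega)
  haveI : Fintype (degLEMonomials n) := (GKSS2017.degLEMonomials_finite n).fintype
  -- `|degLEMonomials n| = C(2n,n) ≤ 2^(2n) < 2^(4n)`
  have hcard : Fintype.card (degLEMonomials n) < 2 ^ (2 * 2 * n) := by
    rw [← Nat.card_eq_fintype_card, GKSS2017.card_degLEMonomials]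
    calc (2 * n).choose n ≤ 2 ^ (2 * n) := Nat.choose_le_two_pow _ _
      _ < 2 ^ (2 * 2 * n) := Nat.pow_lt_pow_right (by norm_num) (by omega)
  -- the generator annihilates no nonzero PROP (`stub_readOnceGenerator`)
  have hgen := stub_readOnceGenerator (degLEMonomials n) (Fin n) (2 * 2 * n)
    (fun μ => ∏ i : Fin n, Polynomial.aeval (X i : MvPolynomial (Fin n) ℂ) (ℓ ((μ : Fin n →₀ ℕ) i)))
    (fun ν i => (((ν : Fin n →₀ ℕ) i : ℕ) : ℂ)) (GeneratorGlue.eval_indicator hℓ) hcard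
    (fun μ => coeff (μ : Fin n →₀ ℕ) f₀) D S hS hD0
  -- realisability of every value of the generator in `SmallCircuits ℂ n 10`, then the principle
  refine Generator.exists_mem_smallCircuits_of_aeval_ne_zero (fun p => ?_) hgen
  choose Λ hΛmem hΛcoeff using fun j : Fin (2 * 2 * n) =>
    stub_separableCoeff n (by omega) (fun i k => (ℓ k).eval (p (Sum.inr (j, i))))
  refine ⟨f₀ + ∑ j : Fin (2 * 2 * n), C (p (Sum.inl j)) * Λ j,
    GeneratorGlue.add_sum_mem_smallCircuits (GeneratorGlue.size_budget (a := 2) (by omega)) hf₀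
      hΛmem _, fun μ => ?_⟩
  rw [GeneratorGlue.coeff_add_sum, GeneratorGlue.eval_generator]
  simp only [GeneratorGlue.eval_prod_aeval, hΛcoeff]

end Summit.ValiantsHypothesis.ValiantsHypothesis.Theorems.BarrierLever.SuccinctHittingSetsForVP

end
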